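import Summits.KontsevichZagierPeriods.Zeta5Search.WedgeDictionaryLevelDescentVFullLayer0
import HarnessLib

/-!
# Level descent for `U ∧ V` on the unclean cone — §E.4: `levelDescentVFull` LITERALLY on the whole first unclean layer (gen-1 g8/g9)

HONEST FRAMING: systematic search; no irrationality claim unless certified.

DELTA file (gen-1 g9): the tree file `WedgeDictionaryLevelDescentVFullLayer0` (p220141) already contains §E.3 — the graded reduction
`PVF_graded_holds` ((T3) `ldSE_rowSource_upto L` on the row layers `c₁₂ ≤ L` ⟹ the corrected constant row `casUV + SE = ldSum V`
on `{φ ≤ L + 1} ∩ RW`) and `PVF_firstLayer_holds` (the whole first unclean layer `φ ≤ 1`).  This file adds only the last step of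
gen-1 g8's staged `…FirstLayer` (93aae24b…), re-based on the tree:

* `ldBoxVF_firstLayer` — `casUVE b = ldSum coeffV b` on the `LDBoxHyp` region with `φ(b) ≤ 1` (incl. the degenerate `N = 0` shapes);
* `levelDescentVFull_firstLayer_holds : levelDescentVFull_firstLayer_stmt` — **the conjecture `levelDescentVFull` LITERALLY (its own
  `(b, j)`-body and hypotheses) at every shape of its region with `φ(b) ≤ 1`** — the first theorem of the level-descent programme off
  the clean cone `c₁₂ ≤ b₇`, all arrangements of the slots `1, 2, 7`, no `Π₂`-proviso.

Memo: `HOME/pub-zeta5-gen-1/D2-VFULL-PROOF-g8.md` §8.7, `HOME/pub-zeta5-gen-1/D2-T3-g9.md`.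
-/

open Finset Polynomial

namespace Summit.KontsevichZagierPeriods.Zeta5Search.WedgeDictionary

open Summit.KontsevichZagierPeriods.Zeta5Search.DualSeries
open Literature.NumberTheory.Transcendental

/-! ### The literal conjecture on the first unclean layer -/

/-- The corrected constant row on the `LDBoxHyp` region intersected with `{φ ≤ 1}` (cf. `ldBoxVF_of_rowSource`). -/
theorem ldBoxVF_firstLayer (b : ℕ → ℤ) (hb : LDBoxHyp b) (hphi : phi b ≤ 1) : casUVE b = ldSum coeffV b := by
  by_cases hN : b 0 = 0
  · have hV := (ldZero_holds coeffU_faceExt_holds b hb hN).2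
    have hs := (inBox_iff b).1 hb.1
    have hE : ldSE b = 0 := ldSE_eq_zero_of_clean b (by unfold sigmaT; omega)
    unfold casUVE
    rw [hE, add_zero]
    exact hV
  · exact ldInductionVF_upto 0 ldSE_rowSource_upto_zero 1 (by norm_num) b (RW_of_LDBoxHyp b hb) (by have := hb.1.1; omega)
      (by exact_mod_cast hphi)

/-- STATEMENT (PROVED as `levelDescentVFull_firstLayer_holds`): **`levelDescentVFull` literally — its own `(b, j)`-body under its own
hypotheses — at every shape of its region on the first unclean layer `φ(b) = b₀ − max(b₁+b₂, b₁+b₇, b₂+b₇) ≤ 1`.** -/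
def levelDescentVFull_firstLayer_stmt : Prop :=
  ∀ (b : ℕ → ℤ) (j : ℕ), j ∈ Icc 1 7 → InBox b → (∀ k ∈ Icc 1 7, 2 * b k ≤ b 0) → 0 ≤ dOf b →
    b 0 - b 1 - b 2 ≤ dOf b + max 0 (max (b 7 - b 1) (b 7 - b 2)) → phi b ≤ 1 →
    coeffU b * coeffV (Function.update b j (b j + 1)) - coeffU (Function.update b j (b j + 1)) * coeffV b =
      (∑ i ∈ Icc (max 0 (max (b 7 - b 1) (b 7 - b 2))) (min (b 0 - b 1 - b 2) (b 7)), ldWeight b i * coeffV (degShape b i)) -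
        ∑ i ∈ Icc (b 7 + 1) (b 0 - b 1 - b 2), ldBoundary b i

/-- PROOF of `levelDescentVFull_firstLayer_stmt`: `wedgeSlotFree` (U-V row), the `i ↦ m` reindexing `ldW_rhs_reindex`, the boundary
sum `ldBoundary_sum_eq_ldSE`, and `ldBoxVF_firstLayer`. -/
theorem levelDescentVFull_firstLayer_holds : levelDescentVFull_firstLayer_stmt := by
  intro b j hj hbox hB hd hcl hphi
  have hb := ldBox_bounds b hbox hB
  have h7 := hb 7 (by simp)
  have h1 := hb 1 (by simp)
  have h2 := hb 2 (by simp)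
  have hjb := hb j hj
  obtain ⟨-, hUV⟩ := wedgeSlotFree_holds b j hj hbox hd (by omega) (by omega)
  rw [hUV, ldW_rhs_reindex coeffV b hb (b 0) (by omega), ldBoundary_sum_eq_ldSE b hbox.1 hb]
  have key := ldBoxVF_firstLayer b ⟨hbox, hB, hd, hcl⟩ hphi
  unfold casUVE ldSum at key
  linear_combination key

end Summit.KontsevichZagierPeriods.Zeta5Search.WedgeDictionary
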